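import Summits.QuantumFields.BalabanUV.T4Continuum.Support.NE7AbelianEffectiveFormCurved
import Summits.QuantumFields.BalabanUV.T4Continuum.Support.NE7ClassMinimiserLoops
import HarnessLib

/-!
# NE7AbelianEffectiveFormCurvedClass — THE U(1)-SECTOR CURVED TWO-SIDED COMPARISON, UNCONDITIONALLY IN THE CLASS:
# `(1 − ε·L^{−2(j+1)})·D²m_1(0)[v,v] ≤ D²m_{V₀}(0)[v,v] ≤ (1 + ε·L^{−2(j+1)})·D²m_1(0)[v,v]` for EVERY small datum `V₀` and EVERY class minimiser over it (`d = 4`, commuting colour algebra, `L ≥ 2`)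

Lineage `b2b-balaban-t4-ne7-p1` (CRUX PROVER NE7 #1 = OWNER of BINDER row NE7), generation 116 — brick 6c of ROAD-G116 §8: ✓ `NE7AbelianEffectiveFormCurved.abelian_effectiveForm_curved_two_sided`
with its binder («the minimiser's iterated averages have loop radius ≤ 1/4 at the levels m ≤ j») DISCHARGED by ✓ `NE7ClassMinimiserLoops.loops_small_of_sfClass` (class membership of the
minimiser + ✓ `NE7RadIterUniform`: the Prop-1 radii stay within a factor 2 of the scale-covariant values), at the price of three explicit `L`-dependent thresholds folded into `ε₀`.
**`abelian_effectiveForm_curved_two_sided_class`**: `∃ ε₀ > 0, ∀ 0 < ε ≤ ε₀, ∀ N ≥ 1, ∀ j, ∃ δ_V > 0, ∀` unitary `N`-periodic `δ_V`-small `V₀`, `∀` minimiser `U♯ ∈ sfClass 4 L N ε (j+1)` over `V₀`, `∀ v`: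
the display above.  With ✓ `NE7EffectiveFormCoarseCurlAllLevels` (floor 1) and row NE7b's ✓ `NE7EffectiveFormCurlEquivalence` (ceiling `homC 4`): in the abelian sector Bałaban's CURVED
variational quadratic form is uniformly (in `j`, `N`) equivalent to the coarse Maxwell form at every small datum.  [folklore]; 0 def, 0 sorry.
HONEST FRAMING: U(1)∕commuting sector (`hcomm`, e.g. `[Unique n]`); OUR minimisers (B11 (8) with `sfClass`); `∀ j ∃ δ_V(j)` (the road's level-dependent datum radius); nothing of Bałaban's
asserted; NOT NE7 as a spine node; spine 0∕9; NOT infinite volume, NOT mass gap, NOT BetaPertH, NOT Clay.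
-/

set_option autoImplicit false

open scoped BigOperators Matrix Matrix.Norms.L2Operator Topology
open NormedSpace Finset Set Filter Metric

namespace Summit.QuantumFields.BalabanUV.T4Continuum.NE7AbelianEffectiveFormCurvedClass

open Literature.MathematicalPhysics.QuantumFieldTheory.Balaban1983to89
open B7Prop1Explicit B7Prop2Explicit
open T4AveragingDeficitWall (IsUnitaryCfg SmallField)
open T4AveragingDeficitWallBoundary (IsPeriodicCfg)
open AveragingDeficitTorusChart (TDir chart)
open AveragingDeficitTwoLevelPrep (skewSub twoLevelSmall)
open MinimalActionSandwich (IsMinimiser minAct)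
open MinimalActionRate (sfClass)
open MinimalActionWitness (flatCfg)
open NE7RadIterUniform (radD)
open NE7ClassMinimiserLoops (loops_small_of_sfClass)
open NE7AbelianEffectiveFormCurved (abelian_effectiveForm_curved_two_sided)

noncomputable section

variable {n : Type} [Fintype n] [DecidableEq n]

/-- **THE U(1)-SECTOR CURVED EFFECTIVE FORM IS THE FLAT ONE UP TO `1 ± ε·L^{−2(j+1)}`, FOR EVERY CLASS MINIMISER** (see the module docstring). [folklore] -/
theorem abelian_effectiveForm_curved_two_sided_class [Nonempty n] (hcomm : ∀ a b : Matrix n n ℂ, Commute a b) {L : ℕ} [NeZero L] (hL : 2 ≤ L) :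
    ∃ ε₀ : ℝ, 0 < ε₀ ∧ ∀ ε : ℝ, 0 < ε → ε ≤ ε₀ → ∀ (N : ℕ) [NeZero N], 1 ≤ N → ∀ j : ℕ,
      ∃ δV : ℝ, 0 < δV ∧
        ∀ V₀ ∈ {V : Site 4 → Fin 4 → (Matrix n n ℂ)ˣ | IsUnitaryCfg V ∧ IsPeriodicCfg V (N : ℤ) ∧ SmallField V δV},
        ∀ Us : Site 4 → Fin 4 → (Matrix n n ℂ)ˣ, IsMinimiser 4 (sfClass 4 L N ε) L N (j + 1) V₀ Us →
          ∀ v : ↥(skewSub 4 n N),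
            (1 - ε / ((L : ℝ) ^ (j + 1)) ^ 2) *
                fderiv ℝ (fderiv ℝ (fun y : ↥(skewSub 4 n N) => minAct 4 (sfClass 4 L N ε) L N (j + 1)
                  (chart (ContinuousLinearMap.id ℝ (Matrix n n ℂ)) N (flatCfg : Site 4 → Fin 4 → (Matrix n n ℂ)ˣ) (y : TDir 4 n N)))) 0 v v
              ≤ fderiv ℝ (fderiv ℝ (fun y : ↥(skewSub 4 n N) => minAct 4 (sfClass 4 L N ε) L N (j + 1)
                  (chart (ContinuousLinearMap.id ℝ (Matrix n n ℂ)) N V₀ (y : TDir 4 n N)))) 0 v v ∧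
            fderiv ℝ (fderiv ℝ (fun y : ↥(skewSub 4 n N) => minAct 4 (sfClass 4 L N ε) L N (j + 1)
                  (chart (ContinuousLinearMap.id ℝ (Matrix n n ℂ)) N V₀ (y : TDir 4 n N)))) 0 v v
              ≤ (1 + ε / ((L : ℝ) ^ (j + 1)) ^ 2) *
                fderiv ℝ (fderiv ℝ (fun y : ↥(skewSub 4 n N) => minAct 4 (sfClass 4 L N ε) L N (j + 1)
                  (chart (ContinuousLinearMap.id ℝ (Matrix n n ℂ)) N (flatCfg : Site 4 → Fin 4 → (Matrix n n ℂ)ˣ) (y : TDir 4 n N)))) 0 v v := by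
  obtain ⟨ε₁, hε₁, H⟩ := abelian_effectiveForm_curved_two_sided (n := n) hcomm hL
  -- the three thresholds of `loops_small_of_sfClass` at `d = 4`
  set q : ℝ := ((L : ℝ) ^ 2)⁻¹ with hq
  have hL2 : (0 : ℝ) < (L : ℝ) ^ 2 := by positivity
  have hq0 : 0 < q := by positivity
  have hD0 : 0 < radD 4 L := by unfold radD; positivity
  have hT0 : 0 < twoLevelSmall 4 L := by unfold twoLevelSmall; positivity
  set t₁ : ℝ := 1 / (4 * radD 4 L * q ^ 2) with ht₁
  set t₂ : ℝ := 1 / (twoLevelSmall 4 L * 2 * q) with ht₂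
  set t₃ : ℝ := 1 / (1024 * ((4 : ℝ) + 1) * ((4 : ℝ) + 4)) with ht₃
  have ht₁0 : 0 < t₁ := by positivity
  have ht₂0 : 0 < t₂ := by positivity
  have ht₃0 : 0 < t₃ := by positivity
  refine ⟨min ε₁ (min t₁ (min t₂ t₃)), lt_min hε₁ (lt_min ht₁0 (lt_min ht₂0 ht₃0)), fun ε hε hεle N _ hN j => ?_⟩
  have hε1 : ε ≤ ε₁ := hεle.trans (min_le_left _ _)
  have hεt₁ : ε ≤ t₁ := hεle.trans ((min_le_right _ _).trans (min_le_left _ _))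
  have hεt₂ : ε ≤ t₂ := hεle.trans ((min_le_right _ _).trans ((min_le_right _ _).trans (min_le_left _ _)))
  have hεt₃ : ε ≤ t₃ := hεle.trans ((min_le_right _ _).trans ((min_le_right _ _).trans (min_le_right _ _)))
  have hεD : 4 * ε * radD 4 L * q ^ 2 ≤ 1 := by
    have h := mul_le_mul_of_nonneg_right hεt₁ (by positivity : (0 : ℝ) ≤ 4 * radD 4 L * q ^ 2)
    rw [ht₁, one_div, inv_mul_cancel₀ (by positivity)] at h
    linarith
  have hεT : twoLevelSmall 4 L * (2 * ε * q) ≤ 1 := by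
    have h := mul_le_mul_of_nonneg_right hεt₂ (by positivity : (0 : ℝ) ≤ twoLevelSmall 4 L * 2 * q)
    rw [ht₂, one_div, inv_mul_cancel₀ (by positivity)] at h
    linarith
  have hε1024 : 1024 * (((4 : ℕ) : ℝ) + 1) * (((4 : ℕ) : ℝ) + 4) * ε ≤ 1 := by
    have h := mul_le_mul_of_nonneg_right hεt₃ (by positivity : (0 : ℝ) ≤ 1024 * ((4 : ℝ) + 1) * ((4 : ℝ) + 4))
    rw [ht₃, one_div, inv_mul_cancel₀ (by positivity)] at h
    push_cast
    linarith
  obtain ⟨δV, hδV, Hcur⟩ := H ε hε hε1 N hN j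
  refine ⟨δV, hδV, fun V₀ hV₀ Us hUs v => ?_⟩
  exact Hcur V₀ hV₀ Us hUs (loops_small_of_sfClass (d := 4) hL hε.le hεD hεT hε1024 j hUs.mem.1) v

end

end Summit.QuantumFields.BalabanUV.T4Continuum.NE7AbelianEffectiveFormCurvedClass
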